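import Literature.Analysis.FluidPDE.MollifiedWeakEuler
import Literature.Analysis.FluidPDE.NavierStokesReynolds
import Literature.Analysis.FunctionSpaces.TorusFluidGlueProofs
import Literature.Analysis.FunctionSpaces.TorusInverseLaplacianCalculus
import HarnessLib

/-!
# The space–time mollification of a classical Navier–Stokes–Reynolds triple solves
  Navier–Stokes–Reynolds up to a gradient

Analysis/FluidPDE support file (everything proved) for the mollification step of the intermittent
convex-integration scheme (Buckmaster–Vicol, Ann. of Math. 189 (2019), §4.1: "`v_ℓ = (v_q ∗ₓ φ_ℓ) ∗ₜ φ_ℓ`,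
`R̊_ℓ = (R̊_q ∗ₓ φ_ℓ) ∗ₜ φ_ℓ` … obey `∂ₜv_ℓ + div(v_ℓ ⊗ v_ℓ) + ∇p_ℓ - Δv_ℓ = div(R̊_ℓ + R̃_commutator)`";
EMS Surv. 6 (2019), §7.3 (7.5)–(7.6)), the `ν`/`R` twin of `MollifiedWeakEuler` (which treats a weak
Euler solution). For a classical triple `(v, p, R)` on `[0, T] × 𝕋^d` (`Torus.IsNSReynoldsOn`),
extended by zero off the slab (`Torus.zeroExt`), the residual of the space–time mollified fields

  `∂ₜV + div 𝒯 - νΔV - div ℛ_ℓ`,  `V = mollifiedField φ ε U`, `𝒯 = mollifiedFlux φ ε U`,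
  `ℛ_ℓ = mollifiedStress φ ε RU` (column-wise mollification of the stress),

is `L²`-orthogonal to every smooth divergence-free field at every time whose `ρ`-window lies in
`(0, T)` (`Torus.integral_inner_mollifiedNSRResidual_eq_zero`) — hence a gradient (pressure
reconstruction downstream). Steps: the weak identity of the classical triple
(`Torus.IsNSReynoldsOn.weak_identity`) tested with the product field `ρ(t - ·) ⊗ W`; the accepted
Steps 2–3 of `MollifiedWeakEuler` for `∂ₜV`, `div 𝒯`; and the two new pairings
`∫⟪ΔV(t), w⟫ = ∫ ρ(t-s) ∫⟪U(s), Δ(w ⋆ k_ε)⟫`, `∫⟪div ℛ_ℓ(t), w⟫ = -∫ ρ(t-s) ∫ ∑ⱼ ⟪RU(s)ⱼ, ∂ⱼ(w ⋆ k_ε)⟫`.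

## References

* T. Buckmaster, V. Vicol, Ann. of Math. 189 (2019) = arXiv:1709.10033, §4.1. [`BuckmasterVicol2019Annals`]
* T. Buckmaster, V. Vicol, EMS Surv. Math. Sci. 6 (2019) = arXiv:1901.09023, §7.3 (7.5)–(7.6). [`BuckmasterVicol2020`]
-/

noncomputable section

open MeasureTheory TopologicalSpace Set Function Filter Metric ContinuousLinearMap
open _root_.Topology
open scoped ENNReal NNReal Convolution InnerProductSpace ContDiff

namespace Literature.Analysis.FluidPDE

namespace Torus

open FunctionSpaces.Torus (stLift lift kernel IsSmooth IsContDiff IsDivFree mollifiedField vecMollify)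
open FunctionSpaces (timeAvgWith)

variable {d : Type*} [Fintype d] [DecidableEq d]

/-! ## Step 0: moving the mollifier onto the test function, for general admissible data -/

section Generic

variable {W : ℝ → UnitAddTorus d → EuclideanSpace ℝ d} {φ : ContDiffBump (0 : ℝ)} {ε A T₀ : ℝ}

omit [DecidableEq d] in
/-- Coordinates of the real inner product on `ℝ^d`. [folklore] -/
private theorem inner_eq_sum_mul_coord' (a b : EuclideanSpace ℝ d) : ⟪a, b⟫_ℝ = ∑ i, a i * b i := by
  rw [PiLp.inner_apply]
  refine Finset.sum_congr rfl fun i _ => ?_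
  simp only [RCLike.inner_apply, conj_trivial, mul_comm]

omit [DecidableEq d] in
/-- **Step 0.** `∫ Vᵢ(t) g = ∫ ρ(t - s) (∫ Wᵢ(s) (g ⋆ k_ε)) ds` for the space–time mollification
`V = mollifiedField φ ε W` of bounded measurable data supported in a slab and a continuous `g`
(Fubini and the symmetry of the even kernel). [folklore] -/
theorem integral_mollifiedField_apply_mul (hWm : StronglyMeasurable (uncurry W))
    (hWb : ∀ s y, ‖W s y‖ ≤ A) (hW0 : ∀ s, s ∉ Icc 0 T₀ → W s = 0) (hε : 0 < ε) (hε' : ε ≤ 1 / 4)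
    (i : d) {g : UnitAddTorus d → ℝ} (hg : Continuous g) (t : ℝ) :
    ∫ x, mollifiedField φ ε W t x i * g x =
      ∫ s, φ.normed volume (t - s) * ∫ y, W s y i * (g ⋆ kernel ε) y := by
  have hWi : Integrable (uncurry W) ((volume : Measure ℝ).prod volume) :=
    integrable_uncurry_of_bounded hWm hWb hW0
  have hk : Continuous (kernel (d := d) ε) := FunctionSpaces.Torus.continuous_kernel hε hε'
  have hke : ∀ z : UnitAddTorus d, kernel ε (-z) = kernel ε z := FunctionSpaces.Torus.kernel_neg hε hε'
  have hWim : StronglyMeasurable (uncurry fun s y => W s y i) := stronglyMeasurable_uncurry_apply hWm i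
  have hWib : ∀ s y, ‖W s y i‖ ≤ A := fun s y => (PiLp.norm_apply_le (W s y) i).trans (hWb s y)
  obtain ⟨hΘm, hΘb⟩ := stronglyMeasurable_convolution_slice hWim hWib hε hε'
  have h1 : ∀ x, mollifiedField φ ε W t x i =
      ∫ s, φ.normed volume (t - s) * ((fun y => W s y i) ⋆ kernel ε) x := fun x => by
    rw [mollifiedField_apply_eq_timeAvgWith hWi hε hε', FunctionSpaces.timeAvgWith_eq_integral_sub]
    simp only [smul_eq_mul]
  simp_rw [h1]
  rw [integral_integral_kernel_mul_comm hΘm hΘb φ.integrable_normed hg t]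
  refine integral_congr_ae (Eventually.of_forall fun s => ?_)
  show φ.normed volume (t - s) * ∫ x, ((fun y => W s y i) ⋆ kernel ε) x * g x =
    φ.normed volume (t - s) * ∫ y, W s y i * (g ⋆ kernel ε) y
  rw [FunctionSpaces.Torus.integral_mul_convolution_comm ((integrable_slice hWm hWb s).eval_piLp i)
    hg.integrable_unitAddTorus hk hke]

end Generic

/-! ## The mollified stress and Step 5 -/

section Stress

variable (φ : ContDiffBump (0 : ℝ)) (ε : ℝ) (RU : ℝ → UnitAddTorus d → d → EuclideanSpace ℝ d)

/-- **The space–time mollified stress** `ℛ_ℓ = (R ∗ₓ φ_ℓ) ∗ₜ φ_ℓ`, column by column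
(`Torus.mollifiedField` of the columns of `RU`). [cite: BuckmasterVicol2019Annals, §4.1] -/
def mollifiedStress (t : ℝ) (x : UnitAddTorus d) : d → EuclideanSpace ℝ d :=
  fun j => mollifiedField φ ε (fun s y => RU s y j) t x

variable {φ ε RU} {A T₀ : ℝ}

omit [DecidableEq d] in
/-- Unfolding the columns of the mollified stress. [folklore] -/
theorem mollifiedStress_apply (t : ℝ) (x : UnitAddTorus d) (j : d) :
    mollifiedStress φ ε RU t x j = mollifiedField φ ε (fun s y => RU s y j) t x := rfl

omit [DecidableEq d] in
/-- Columns of measurable bounded slab-supported tensor data are admissible vector data. [folklore] -/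
theorem column_data (hRm : StronglyMeasurable (uncurry RU)) (hRb : ∀ s y, ‖RU s y‖ ≤ A)
    (hR0 : ∀ s, s ∉ Icc 0 T₀ → RU s = 0) (j : d) :
    StronglyMeasurable (uncurry fun s y => RU s y j) ∧ (∀ s y, ‖RU s y j‖ ≤ A) ∧
      ∀ s, s ∉ Icc 0 T₀ → (fun y => RU s y j) = 0 := by
  refine ⟨(continuous_apply j).comp_stronglyMeasurable hRm, fun s y => (norm_le_pi_norm (RU s y) j).trans (hRb s y),
    fun s hs => ?_⟩
  funext y; simp [hR0 s hs]

omit [DecidableEq d] in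
/-- The mollified stress is smooth in space. [folklore] -/
theorem isSmooth_mollifiedStress (hRm : StronglyMeasurable (uncurry RU)) (hRb : ∀ s y, ‖RU s y‖ ≤ A)
    (hR0 : ∀ s, s ∉ Icc 0 T₀ → RU s = 0) (hε : 0 < ε) (hε' : ε ≤ 1 / 4) (t : ℝ) :
    IsSmooth (mollifiedStress φ ε RU t) := by
  refine isSmooth_tensor fun j => ?_
  obtain ⟨hm, hb, h0⟩ := column_data hRm hRb hR0 j
  exact isSmooth_mollifiedField (integrable_uncurry_of_bounded hm hb h0) hε hε' t

/-- **Step 5.** `∫ ⟪div ℛ_ℓ(t), w⟫ = -∫ ρ(t - s) (∫ ∑ⱼ ⟪RU(s)ⱼ, ∂ⱼ(w ⋆ k_ε)⟫) ds` for a smooth `w`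
(no boundary on the torus, Step 0 entrywise, `∂ⱼ(wᵢ ⋆ k_ε) = (∂ⱼwᵢ) ⋆ k_ε`). [folklore] -/
theorem integral_inner_tensorDivergence_mollifiedStress (hRm : StronglyMeasurable (uncurry RU))
    (hRb : ∀ s y, ‖RU s y‖ ≤ A) (hR0 : ∀ s, s ∉ Icc 0 T₀ → RU s = 0) (hε : 0 < ε) (hε' : ε ≤ 1 / 4)
    {w : UnitAddTorus d → EuclideanSpace ℝ d} (hw : IsSmooth w) (t : ℝ) :
    ∫ x, ⟪tensorDivergence (mollifiedStress φ ε RU t) x, w x⟫_ℝ =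
      -∫ s, φ.normed volume (t - s) *
        ∫ y, ∑ j, ⟪RU s y j, FunctionSpaces.Torus.partialDeriv j (vecMollify ε w) y⟫_ℝ := by
  have hA : 0 ≤ A := (norm_nonneg _).trans (hRb 0 0)
  have hk : Continuous (kernel (d := d) ε) := FunctionSpaces.Torus.continuous_kernel hε hε'
  have hks : IsSmooth (kernel (d := d) ε) := FunctionSpaces.Torus.isSmooth_kernel hε hε'
  have hT : IsSmooth (mollifiedStress φ ε RU t) := isSmooth_mollifiedStress hRm hRb hR0 hε hε' t
  -- `gⱼᵢ = ∂ⱼwᵢ`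
  set g : d → d → UnitAddTorus d → ℝ := fun j i => FunctionSpaces.Torus.partialDeriv j (fun y => w y i) with hg
  have hwi : ∀ i, IsSmooth fun y => w y i := fun i => hw.apply i
  have hgc : ∀ j i, Continuous (g j i) := fun j i => ((hwi i).partialDeriv j).continuous
  have hW : IsSmooth (vecMollify ε w) := FunctionSpaces.Torus.isSmooth_vecMollify hw.integrable hε hε'
  have hdW : ∀ j i x, FunctionSpaces.Torus.partialDeriv j (fun y => vecMollify ε w y i) x = (g j i ⋆ kernel ε) x := by
    intro j i x
    have hfun : (fun y => vecMollify ε w y i) = (fun y => w y i) ⋆ kernel ε := by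
      funext y; rw [FunctionSpaces.Torus.vecMollify_apply]
    rw [hfun, FunctionSpaces.Torus.partialDeriv_convolution (hwi i).integrable hks,
      FunctionSpaces.Torus.convolution_partialDeriv_right (hwi i) hks]
  obtain ⟨Cg, hCg⟩ : ∃ Cg, ∀ j i x, ‖(g j i ⋆ kernel (d := d) ε) x‖ ≤ Cg := by
    have h : ∀ j i, ∃ C, ∀ x, ‖(g j i ⋆ kernel (d := d) ε) x‖ ≤ C := fun j i =>
      FunctionSpaces.Torus.exists_forall_norm_le_of_continuous
        (FunctionSpaces.Torus.continuous_convolution (hgc j i).integrable_unitAddTorus hk)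
    choose C hC using h
    refine ⟨∑ j, ∑ i, |C j i|, fun j i x => (hC j i x).trans ((le_abs_self _).trans ?_)⟩
    exact (Finset.single_le_sum (fun i _ => abs_nonneg (C j i)) (Finset.mem_univ i)).trans
      (Finset.single_le_sum (fun j _ => Finset.sum_nonneg fun i _ => abs_nonneg (C j i)) (Finset.mem_univ j))
  have hgkc : ∀ j i, Continuous (g j i ⋆ kernel (d := d) ε) := fun j i =>
    FunctionSpaces.Torus.continuous_convolution (hgc j i).integrable_unitAddTorus hk
  -- column data and the coordinates of the time integral
  have hcol := fun j => column_data hRm hRb hR0 j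
  set c : d → d → ℝ → ℝ := fun j i s => ∫ y, RU s y j i * (g j i ⋆ kernel ε) y with hc
  have hRji_m : ∀ j i, StronglyMeasurable (uncurry fun s y => RU s y j i) := fun j i =>
    stronglyMeasurable_uncurry_apply (hcol j).1 i
  have hRji_b : ∀ j i s y, ‖RU s y j i‖ ≤ A := fun j i s y => (PiLp.norm_apply_le (RU s y j) i).trans ((hcol j).2.1 s y)
  have hci : ∀ j i, StronglyMeasurable (c j i) ∧ ∀ s, ‖c j i s‖ ≤ A * Cg := fun j i =>
    stronglyMeasurable_integral_mul (hRji_m j i) (hRji_b j i) (hgkc j i) (hCg j i)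
  have hρt : Integrable (fun s => φ.normed volume (t - s)) volume := φ.integrable_normed.comp_sub_left t
  have hIi : ∀ j i, Integrable (fun s => φ.normed volume (t - s) * c j i s) volume := fun j i =>
    hρt.mul_bdd (hci j i).1.aestronglyMeasurable (Eventually.of_forall (hci j i).2)
  have hsl : ∀ j i s, Integrable (fun y => RU s y j i * (g j i ⋆ kernel ε) y) volume := by
    intro j i s
    have h1 : Integrable (fun y => RU s y j i) volume := (integrable_slice (hcol j).1 (hcol j).2.1 s).eval_piLp i
    exact h1.mul_bdd (hgkc j i).aestronglyMeasurable (Eventually.of_forall (hCg j i))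
  have hTc : ∀ j i, Continuous fun x => mollifiedStress φ ε RU t x j i := fun j i =>
    continuous_euclidean_apply ((continuous_apply j).comp hT.continuous) i
  -- left-hand side
  have hL : ∫ x, ⟪tensorDivergence (mollifiedStress φ ε RU t) x, w x⟫_ℝ = -∑ j, ∑ i, ∫ s, φ.normed volume (t - s) * c j i s := by
    rw [integral_inner_tensorDivergence hT hw]
    congr 1
    have hentry : ∀ x, ∑ j, ⟪mollifiedStress φ ε RU t x j, FunctionSpaces.Torus.partialDeriv j w x⟫_ℝ =
        ∑ j, ∑ i, mollifiedStress φ ε RU t x j i * g j i x := fun x => by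
      refine Finset.sum_congr rfl fun j _ => ?_
      rw [inner_eq_sum_mul_coord']
      refine Finset.sum_congr rfl fun i _ => ?_
      rw [← FunctionSpaces.Torus.partialDeriv_apply_coord (hw.isContDiff (by simp)) j x i]
    simp_rw [hentry]
    rw [integral_finsetSum _ fun j _ => integrable_finsetSum _ fun i _ =>
      (show Integrable (fun x => mollifiedStress φ ε RU t x j i * g j i x) volume from
        ((hTc j i).mul (hgc j i)).integrable_unitAddTorus)]
    refine Finset.sum_congr rfl fun j _ => ?_
    rw [integral_finsetSum _ fun i _ =>
      (show Integrable (fun x => mollifiedStress φ ε RU t x j i * g j i x) volume from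
        ((hTc j i).mul (hgc j i)).integrable_unitAddTorus)]
    refine Finset.sum_congr rfl fun i _ => ?_
    exact integral_mollifiedField_apply_mul (hcol j).1 (hcol j).2.1 (hcol j).2.2 hε hε' i (hgc j i) t
  -- right-hand side
  have hslice : ∀ s, ∫ y, ∑ j, ⟪RU s y j, FunctionSpaces.Torus.partialDeriv j (vecMollify ε w) y⟫_ℝ = ∑ j, ∑ i, c j i s := by
    intro s
    rw [← Finset.sum_congr rfl fun j _ => integral_finsetSum _ fun i _ => hsl j i s,
      ← integral_finsetSum _ fun j _ => integrable_finsetSum _ fun i _ => hsl j i s]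
    refine integral_congr_ae (Eventually.of_forall fun y => ?_)
    simp only
    refine Finset.sum_congr rfl fun j _ => ?_
    rw [inner_eq_sum_mul_coord']
    refine Finset.sum_congr rfl fun i _ => ?_
    rw [← FunctionSpaces.Torus.partialDeriv_apply_coord (hW.isContDiff (by simp)) j y i, hdW j i y]
  have hR : ∫ s, φ.normed volume (t - s) * ∫ y, ∑ j, ⟪RU s y j, FunctionSpaces.Torus.partialDeriv j (vecMollify ε w) y⟫_ℝ =
      ∑ j, ∑ i, ∫ s, φ.normed volume (t - s) * c j i s := by
    simp_rw [hslice, Finset.mul_sum]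
    rw [integral_finsetSum _ fun j _ => integrable_finsetSum _ fun i _ => hIi j i]
    refine Finset.sum_congr rfl fun j _ => ?_
    exact integral_finsetSum _ fun i _ => hIi j i
  rw [hL, hR]

end Stress

/-! ## Step 4: the Laplacian of the mollified field against a smooth field -/

section Laplacian

/-- Coordinates commute with the Laplacian: `(Δv)ⱼ = Δ(vⱼ)` for smooth fields. [folklore] -/
private theorem laplacian_apply_coord' {v : UnitAddTorus d → EuclideanSpace ℝ d} (hv : IsSmooth v) (x : UnitAddTorus d)
    (j : d) : FunctionSpaces.Torus.laplacian v x j = FunctionSpaces.Torus.laplacian (fun y => v y j) x := by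
  have h := FunctionSpaces.Torus.laplacian_clm_comp_apply hv (EuclideanSpace.proj j : EuclideanSpace ℝ d →L[ℝ] ℝ) x
  exact h.symm

variable {U : ℝ → UnitAddTorus d → EuclideanSpace ℝ d} {φ : ContDiffBump (0 : ℝ)} {ε M T₀ : ℝ}

/-- **Step 4.** `∫ ⟪ΔV(t), w⟫ = ∫ ρ(t - s) (∫ ⟪U(s), Δ(w ⋆ k_ε)⟫) ds` for a smooth `w` (symmetry of
`Δ` on the torus, Step 0 coordinatewise, `Δ(wᵢ ⋆ k_ε) = (Δwᵢ) ⋆ k_ε`). [folklore] -/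
theorem integral_inner_laplacian_mollifiedField (hUm : StronglyMeasurable (uncurry U))
    (hUb : ∀ s y, ‖U s y‖ ≤ M) (hU0 : ∀ s, s ∉ Icc 0 T₀ → U s = 0) (hε : 0 < ε) (hε' : ε ≤ 1 / 4)
    {w : UnitAddTorus d → EuclideanSpace ℝ d} (hw : IsSmooth w) (t : ℝ) :
    ∫ x, ⟪FunctionSpaces.Torus.laplacian (mollifiedField φ ε U t) x, w x⟫_ℝ =
      ∫ s, φ.normed volume (t - s) * ∫ y, ⟪U s y, FunctionSpaces.Torus.laplacian (vecMollify ε w) y⟫_ℝ := by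
  have hM : 0 ≤ M := (norm_nonneg _).trans (hUb 0 0)
  have hUi : Integrable (uncurry U) ((volume : Measure ℝ).prod volume) := integrable_uncurry_of_bounded hUm hUb hU0
  have hk : Continuous (kernel (d := d) ε) := FunctionSpaces.Torus.continuous_kernel hε hε'
  have hks : IsSmooth (kernel (d := d) ε) := FunctionSpaces.Torus.isSmooth_kernel hε hε'
  have hV : IsSmooth (mollifiedField φ ε U t) := isSmooth_mollifiedField hUi hε hε' t
  have hW : IsSmooth (vecMollify ε w) := FunctionSpaces.Torus.isSmooth_vecMollify hw.integrable hε hε'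
  have hwi : ∀ i, IsSmooth fun y => w y i := fun i => hw.apply i
  -- `gᵢ = Δwᵢ`, and `Δ(vecMollify w)ᵢ = gᵢ ⋆ k_ε`
  set g : d → UnitAddTorus d → ℝ := fun i => FunctionSpaces.Torus.laplacian (fun y => w y i) with hg
  have hgc : ∀ i, Continuous (g i) := fun i => (hwi i).laplacian.continuous
  have hLW : ∀ i y, FunctionSpaces.Torus.laplacian (vecMollify ε w) y i = (g i ⋆ kernel ε) y := by
    intro i y
    rw [laplacian_apply_coord' hW y i]
    have hfun : (fun y => vecMollify ε w y i) = (fun y => w y i) ⋆ kernel ε := by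
      funext y; rw [FunctionSpaces.Torus.vecMollify_apply]
    rw [hfun, FunctionSpaces.Torus.convolution_comm_real (fun y => w y i) (kernel ε),
      FunctionSpaces.Torus.laplacian_convolution hk.integrable_unitAddTorus (hwi i),
      FunctionSpaces.Torus.convolution_comm_real (kernel ε)]
  obtain ⟨Cg, hCg⟩ : ∃ Cg, ∀ i x, ‖(g i ⋆ kernel (d := d) ε) x‖ ≤ Cg := by
    have h : ∀ i, ∃ C, ∀ x, ‖(g i ⋆ kernel (d := d) ε) x‖ ≤ C := fun i =>
      FunctionSpaces.Torus.exists_forall_norm_le_of_continuous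
        (FunctionSpaces.Torus.continuous_convolution (hgc i).integrable_unitAddTorus hk)
    choose C hC using h
    exact ⟨∑ i, |C i|, fun i x => (hC i x).trans ((le_abs_self _).trans
      (Finset.single_le_sum (fun i _ => abs_nonneg (C i)) (Finset.mem_univ i)))⟩
  have hgkc : ∀ i, Continuous (g i ⋆ kernel (d := d) ε) := fun i =>
    FunctionSpaces.Torus.continuous_convolution (hgc i).integrable_unitAddTorus hk
  set c : d → ℝ → ℝ := fun i s => ∫ y, U s y i * (g i ⋆ kernel ε) y with hc
  have hci : ∀ i, StronglyMeasurable (c i) ∧ ∀ s, ‖c i s‖ ≤ M * Cg := fun i =>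
    stronglyMeasurable_integral_mul (stronglyMeasurable_uncurry_apply hUm i)
      (fun s y => (PiLp.norm_apply_le (U s y) i).trans (hUb s y)) (hgkc i) (hCg i)
  have hρt : Integrable (fun s => φ.normed volume (t - s)) volume := φ.integrable_normed.comp_sub_left t
  have hIi : ∀ i, Integrable (fun s => φ.normed volume (t - s) * c i s) volume := fun i =>
    hρt.mul_bdd (hci i).1.aestronglyMeasurable (Eventually.of_forall (hci i).2)
  have hsl : ∀ i s, Integrable (fun y => U s y i * (g i ⋆ kernel ε) y) volume := fun i s =>
    ((integrable_slice hUm hUb s).eval_piLp i).mul_bdd (hgkc i).aestronglyMeasurable (Eventually.of_forall (hCg i))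
  -- left-hand side: `∫⟪ΔV, w⟫ = ∫⟪V, Δw⟫ = ∑ᵢ ∫ Vᵢ gᵢ`
  have hVc : ∀ i, Continuous fun x => mollifiedField φ ε U t x i := fun i => continuous_euclidean_apply hV.continuous i
  have hL : ∫ x, ⟪FunctionSpaces.Torus.laplacian (mollifiedField φ ε U t) x, w x⟫_ℝ = ∑ i, ∫ s, φ.normed volume (t - s) * c i s := by
    rw [FunctionSpaces.Torus.integral_inner_laplacian_comm hV hw]
    have hentry : ∀ x, ⟪mollifiedField φ ε U t x, FunctionSpaces.Torus.laplacian w x⟫_ℝ = ∑ i, mollifiedField φ ε U t x i * g i x := by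
      intro x
      rw [inner_eq_sum_mul_coord']
      refine Finset.sum_congr rfl fun i _ => ?_
      rw [laplacian_apply_coord' hw x i]
    simp_rw [hentry]
    rw [integral_finsetSum _ fun i _ =>
      (show Integrable (fun x => mollifiedField φ ε U t x i * g i x) volume from ((hVc i).mul (hgc i)).integrable_unitAddTorus)]
    refine Finset.sum_congr rfl fun i _ => ?_
    exact integral_mollifiedField_apply_mul hUm hUb hU0 hε hε' i (hgc i) t
  have hslice : ∀ s, ∫ y, ⟪U s y, FunctionSpaces.Torus.laplacian (vecMollify ε w) y⟫_ℝ = ∑ i, c i s := by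
    intro s
    rw [← integral_finsetSum _ fun i _ => hsl i s]
    refine integral_congr_ae (Eventually.of_forall fun y => ?_)
    simp only
    rw [inner_eq_sum_mul_coord']
    refine Finset.sum_congr rfl fun i _ => ?_
    rw [hLW i y]
  have hR : ∫ s, φ.normed volume (t - s) * ∫ y, ⟪U s y, FunctionSpaces.Torus.laplacian (vecMollify ε w) y⟫_ℝ =
      ∑ i, ∫ s, φ.normed volume (t - s) * c i s := by
    simp_rw [hslice, Finset.mul_sum]
    exact integral_finsetSum _ fun i _ => hIi i
  rw [hL, hR]

end Laplacian

/-! ## Zero extension of classical data off the slab -/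

section ZeroExt

variable {X : Type*} {F : Type*} [Zero F]

/-- **Extension by zero off the slab `[0, T]`** of a time-dependent field. [folklore] -/
def zeroExt (T : ℝ) (v : ℝ → X → F) : ℝ → X → F := fun s => if s ∈ Icc 0 T then v s else 0

omit [Fintype d] [DecidableEq d] in
/-- On the slab the extension is the field. [folklore] -/
theorem zeroExt_of_mem {T : ℝ} (v : ℝ → X → F) {s : ℝ} (hs : s ∈ Icc 0 T) : zeroExt T v s = v s := by
  simp [zeroExt, hs]

omit [Fintype d] [DecidableEq d] in
/-- Off the slab the extension vanishes. [folklore] -/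
theorem zeroExt_of_not_mem {T : ℝ} (v : ℝ → X → F) {s : ℝ} (hs : s ∉ Icc 0 T) : zeroExt T v s = 0 := by
  simp [zeroExt, hs]

end ZeroExt

section ZeroExtTorus

variable {F : Type*} [NormedAddCommGroup F] [NormedSpace ℝ F]

omit [Fintype d] [DecidableEq d] [NormedSpace ℝ F] in
/-- Clamping time to `[0,T]` turns a field with space–time lift continuous on `[0,T] × ℝ^d` into a
jointly continuous field (twin of the device in `BuckmasterVicolNonuniquenessIteration`). [folklore] -/
theorem continuous_uncurry_clamp {T : ℝ} (hT : (0 : ℝ) ≤ T) {u : ℝ → UnitAddTorus d → F}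
    (hu : ContinuousOn (stLift u) (Icc 0 T ×ˢ univ)) :
    Continuous (uncurry fun t x => u (projIcc 0 T hT t) x) := by
  refine FunctionSpaces.Torus.continuous_uncurry_of_continuous_stLift ?_
  have h : stLift (fun t x => u (projIcc 0 T hT t) x) =
      stLift u ∘ fun q : ℝ × EuclideanSpace ℝ d => ((projIcc 0 T hT q.1 : ℝ), q.2) := by
    funext q; rfl
  rw [h]
  exact hu.comp_continuous
    ((continuous_subtype_val.comp (continuous_projIcc.comp continuous_fst)).prodMk continuous_snd)
    fun q => ⟨(projIcc 0 T hT q.1).2, mem_univ _⟩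

omit [DecidableEq d] in
/-- **The zero extension of a jointly smooth field on `[0,T]` is strongly measurable on `ℝ × 𝕋^d`.**
[folklore] -/
theorem stronglyMeasurable_uncurry_zeroExt {T : ℝ} (hT : (0 : ℝ) ≤ T) {u : ℝ → UnitAddTorus d → F}
    (hu : FunctionSpaces.Torus.IsSmoothSpaceTimeOn (Icc 0 T) u) :
    StronglyMeasurable (uncurry (zeroExt T u)) := by
  have hc := continuous_uncurry_clamp hT hu.continuousOn
  have e : uncurry (zeroExt T u) = (Icc 0 T ×ˢ (univ : Set (UnitAddTorus d))).indicator
      (uncurry fun t x => u (projIcc 0 T hT t) x) := by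
    funext q
    rcases q with ⟨s, x⟩
    by_cases hs : s ∈ Icc 0 T
    · rw [indicator_of_mem (mk_mem_prod hs (mem_univ x))]
      simp [uncurry, zeroExt, hs, projIcc_of_mem hT hs]
    · rw [indicator_of_notMem (fun hq => hs hq.1)]
      simp [uncurry, zeroExt, hs]
  rw [e]
  exact hc.stronglyMeasurable.indicator (measurableSet_Icc.prod MeasurableSet.univ)

omit [Fintype d] [DecidableEq d] [NormedSpace ℝ F] in
/-- A sup bound on the slab transfers to the zero extension (`M ≥ 0`). [folklore] -/
theorem norm_zeroExt_le {T M : ℝ} (hM : 0 ≤ M) {u : ℝ → UnitAddTorus d → F} (hb : ∀ s ∈ Icc 0 T, ∀ y, ‖u s y‖ ≤ M)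
    (s : ℝ) (y : UnitAddTorus d) : ‖zeroExt T u s y‖ ≤ M := by
  by_cases hs : s ∈ Icc 0 T
  · rw [zeroExt_of_mem u hs]; exact hb s hs y
  · rw [zeroExt_of_not_mem u hs]; simpa using hM

end ZeroExtTorus

/-! ## Step 1': the weak identity of a classical triple tested with the product field -/

section ProductTestNSR

variable {φ : ContDiffBump (0 : ℝ)} {S : Set ℝ} {ν T M A : ℝ} {v : ℝ → UnitAddTorus d → EuclideanSpace ℝ d}
  {p : ℝ → UnitAddTorus d → ℝ} {R : ℝ → UnitAddTorus d → d → EuclideanSpace ℝ d}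

omit [DecidableEq d] in
/-- The Laplacian of the product test field: `Δ(ρ W) = ρ ΔW`. [folklore] -/
theorem laplacian_product (φ : ContDiffBump (0 : ℝ)) (t : ℝ) {W : UnitAddTorus d → EuclideanSpace ℝ d} (hW : IsSmooth W)
    (s : ℝ) (y : UnitAddTorus d) :
    FunctionSpaces.Torus.laplacian (fun y => φ.normed volume (t - s) • W y) y =
      φ.normed volume (t - s) • FunctionSpaces.Torus.laplacian W y := by
  rw [show (fun y => φ.normed volume (t - s) • W y) = φ.normed volume (t - s) • W from rfl,
    FunctionSpaces.Torus.laplacian_const_smul_apply hW]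

/-- The partial derivatives of the product test field: `∂ⱼ(ρ W) = ρ ∂ⱼW`. [folklore] -/
theorem partialDeriv_product (φ : ContDiffBump (0 : ℝ)) (t : ℝ) {W : UnitAddTorus d → EuclideanSpace ℝ d} (hW : IsSmooth W)
    (s : ℝ) (j : d) (y : UnitAddTorus d) :
    FunctionSpaces.Torus.partialDeriv j (fun y => φ.normed volume (t - s) • W y) y =
      φ.normed volume (t - s) • FunctionSpaces.Torus.partialDeriv j W y := by
  rw [show (fun y => φ.normed volume (t - s) • W y) = φ.normed volume (t - s) • W from rfl,
    FunctionSpaces.Torus.partialDeriv_const_smul (hW.isContDiff (by simp))]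
  rfl

/-- **Step 1': the weak identity of a classical Navier–Stokes–Reynolds triple tested with the product
field `ρ(t - ·) ⊗ W`.** For `(v, p, R)` solving the NSR system with viscosity `ν` on `S ⊇ [0, T]`,
sup bounds `‖v‖ ≤ M`, `‖R‖ ≤ A` on the slab, a smooth divergence-free `W`, and `t` with
`[t - rOut, t + rOut] ⊆ (0, T)`: with `U`, `RU` the zero extensions of `v`, `R`,
`∫ ρ'(t-s)∫⟪U(s),W⟫ = ∫ ρ(t-s)∫⟪U(s),(U(s)·∇)W⟫ + ν ∫ ρ(t-s)∫⟪U(s),ΔW⟫ - ∫ ρ(t-s)∫∑ⱼ⟪RU(s)ⱼ,∂ⱼW⟫`.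
[cite: BuckmasterVicol2019Annals, §4.1] -/
theorem weakNSR_product_test (h : IsNSReynoldsOn S ν v p R) (hS : Icc 0 T ⊆ S) (hT : 0 < T)
    (hvb : ∀ s ∈ Icc 0 T, ∀ y, ‖v s y‖ ≤ M) (hRb : ∀ s ∈ Icc 0 T, ∀ y, ‖R s y‖ ≤ A)
    {t : ℝ} (ht1 : φ.rOut < t) (ht2 : t + φ.rOut < T)
    {W : UnitAddTorus d → EuclideanSpace ℝ d} (hW : IsSmooth W) (hdiv : IsDivFree W) :
    ∫ s, deriv (φ.normed volume) (t - s) * ∫ y, ⟪zeroExt T v s y, W y⟫_ℝ =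
      (∫ s, φ.normed volume (t - s) * ∫ y, ⟪zeroExt T v s y, FunctionSpaces.Torus.convect (zeroExt T v s) W y⟫_ℝ) +
      ν * (∫ s, φ.normed volume (t - s) * ∫ y, ⟪zeroExt T v s y, FunctionSpaces.Torus.laplacian W y⟫_ℝ) -
      ∫ s, φ.normed volume (t - s) * ∫ y, ∑ j, ⟪zeroExt T R s y j, FunctionSpaces.Torus.partialDeriv j W y⟫_ℝ := by
  set ρ : ℝ → ℝ := φ.normed volume with hρ
  set U := zeroExt T v with hUdef
  set RU := zeroExt T R with hRUdef
  have hT0 : (0 : ℝ) ≤ T := hT.le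
  have hM : 0 ≤ M := (norm_nonneg _).trans (hvb 0 ⟨le_rfl, hT0⟩ 0)
  have hA : 0 ≤ A := (norm_nonneg _).trans (hRb 0 ⟨le_rfl, hT0⟩ 0)
  have hIcc := h.mono_Icc hS hT
  have hUm : StronglyMeasurable (uncurry U) := stronglyMeasurable_uncurry_zeroExt hT0 hIcc.smooth_velocity
  have hRUm : StronglyMeasurable (uncurry RU) := stronglyMeasurable_uncurry_zeroExt hT0 hIcc.smooth_stress
  have hUb : ∀ s y, ‖U s y‖ ≤ M := norm_zeroExt_le hM hvb
  have hRUb : ∀ s y, ‖RU s y‖ ≤ A := norm_zeroExt_le hA hRb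
  -- bounds on `W`, `DW`, `ΔW`, `∂W`
  obtain ⟨CW, hCW⟩ := FunctionSpaces.Torus.exists_forall_norm_le_of_continuous hW.continuous
  obtain ⟨CD, hCD⟩ := FunctionSpaces.Torus.exists_forall_norm_le_of_continuous (hW.isContDiff (n := 1) (by simp)).continuous_fderiv
  obtain ⟨CL, hCL⟩ := FunctionSpaces.Torus.exists_forall_norm_le_of_continuous hW.laplacian.continuous
  obtain ⟨CP, hCP⟩ : ∃ C, ∀ j y, ‖FunctionSpaces.Torus.partialDeriv j W y‖ ≤ C := by
    have hj : ∀ j, ∃ C, ∀ y, ‖FunctionSpaces.Torus.partialDeriv j W y‖ ≤ C := fun j =>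
      FunctionSpaces.Torus.exists_forall_norm_le_of_continuous (hW.partialDeriv j).continuous
    choose C hC using hj
    exact ⟨∑ j, |C j|, fun j y => (hC j y).trans ((le_abs_self _).trans
      (Finset.single_le_sum (fun j _ => abs_nonneg (C j)) (Finset.mem_univ j)))⟩
  -- the weak identity with the product test field
  have hψ := isSpaceTimeTestIoo_product φ ht1 ht2 hW
  have hraw := h.weak_identity hS hT hψ.isSpaceTimeTest (isDivFreeTest_product φ t hW hdiv)
  have hψ0 : ∀ y, (fun s y => ρ (t - s) • W y) 0 y = 0 := fun y => by
    obtain ⟨h0, -⟩ := normed_sub_eq_zero_of_not_mem φ ht1 ht2 (s := 0) (fun hs => lt_irrefl _ hs.1)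
    change ρ (t - 0) • W y = 0
    rw [show ρ (t - 0) = 0 from h0, zero_smul]
  have hdatum : ∫ y, ⟪v 0 y, (fun s y => ρ (t - s) • W y) 0 y⟫_ℝ = 0 := by
    simp only [hψ0, inner_zero_right, integral_zero]
  rw [hdatum, add_zero] at hraw
  -- rewrite both sides with `U`, `RU` and product-form integrands, on `(0, T)`
  have hid : ∫ s in Ioo 0 T, ∫ y, ((-deriv ρ (t - s)) * ⟪U s y, W y⟫_ℝ +
      ρ (t - s) * ⟪U s y, FunctionSpaces.Torus.convect (U s) W y⟫_ℝ + ν * (ρ (t - s) * ⟪U s y, FunctionSpaces.Torus.laplacian W y⟫_ℝ)) =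
      ∫ s in Ioo 0 T, ∫ y, ρ (t - s) * ∑ j, ⟪RU s y j, FunctionSpaces.Torus.partialDeriv j W y⟫_ℝ := by
    refine Eq.trans (setIntegral_congr_fun measurableSet_Ioo fun s hs => integral_congr_ae (Eventually.of_forall fun y => ?_))
      (hraw.trans (setIntegral_congr_fun measurableSet_Ioo fun s hs => integral_congr_ae (Eventually.of_forall fun y => ?_)))
    · have hsI : s ∈ Icc 0 T := Ioo_subset_Icc_self hs
      change (-deriv ρ (t - s)) * ⟪U s y, W y⟫_ℝ + ρ (t - s) * ⟪U s y, FunctionSpaces.Torus.convect (U s) W y⟫_ℝ +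
        ν * (ρ (t - s) * ⟪U s y, FunctionSpaces.Torus.laplacian W y⟫_ℝ) =
        ⟪v s y, FunctionSpaces.Torus.timeDeriv (fun s y => ρ (t - s) • W y) s y⟫_ℝ +
        ⟪v s y, FunctionSpaces.Torus.convect (v s) (fun y => ρ (t - s) • W y) y⟫_ℝ +
        ν * ⟪v s y, FunctionSpaces.Torus.laplacian (fun y => ρ (t - s) • W y) y⟫_ℝ
      rw [timeDeriv_product, convect_product φ t hW, laplacian_product φ t hW, real_inner_smul_right, real_inner_smul_right,
        real_inner_smul_right, hUdef, zeroExt_of_mem v hsI, neg_mul, ← mul_assoc]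
    · have hsI : s ∈ Icc 0 T := Ioo_subset_Icc_self hs
      change ∑ j, ⟪R s y j, FunctionSpaces.Torus.partialDeriv j (fun y => ρ (t - s) • W y) y⟫_ℝ =
        ρ (t - s) * ∑ j, ⟪RU s y j, FunctionSpaces.Torus.partialDeriv j W y⟫_ℝ
      rw [hRUdef, zeroExt_of_mem R hsI, Finset.mul_sum]
      refine Finset.sum_congr rfl fun j _ => ?_
      rw [partialDeriv_product φ t hW, real_inner_smul_right]
  -- measurability and integrability
  have happly : Continuous fun q : (EuclideanSpace ℝ d →L[ℝ] EuclideanSpace ℝ d) × EuclideanSpace ℝ d => q.1 q.2 :=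
    isBoundedBilinearMap_apply.continuous
  have hDWc : Continuous (FunctionSpaces.Torus.fderiv W) := (hW.isContDiff (n := 1) (by simp)).continuous_fderiv
  have hconv_bd : ∀ s y, ‖FunctionSpaces.Torus.convect (U s) W y‖ ≤ CD * M := fun s y => by
    simp only [FunctionSpaces.Torus.convect]
    exact (le_opNorm _ _).trans (mul_le_mul (hCD y) (hUb s y) (norm_nonneg _) ((norm_nonneg _).trans (hCD y)))
  have hjm1 : StronglyMeasurable (uncurry fun s y => ⟪U s y, W y⟫_ℝ) :=
    hUm.inner (hW.continuous.comp continuous_snd).stronglyMeasurable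
  have hjm2 : StronglyMeasurable (uncurry fun s y => ⟪U s y, FunctionSpaces.Torus.convect (U s) W y⟫_ℝ) := by
    have h1 : StronglyMeasurable fun q : ℝ × UnitAddTorus d => (FunctionSpaces.Torus.fderiv W q.2, uncurry U q) :=
      (hDWc.comp continuous_snd).stronglyMeasurable.prodMk hUm
    exact hUm.inner (happly.comp_stronglyMeasurable h1)
  have hjm3 : StronglyMeasurable (uncurry fun s y => ⟪U s y, FunctionSpaces.Torus.laplacian W y⟫_ℝ) :=
    hUm.inner (hW.laplacian.continuous.comp continuous_snd).stronglyMeasurable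
  have hjm4 : StronglyMeasurable (uncurry fun s y => ∑ j, ⟪RU s y j, FunctionSpaces.Torus.partialDeriv j W y⟫_ℝ) := by
    have e : (uncurry fun s y => ∑ j, ⟪RU s y j, FunctionSpaces.Torus.partialDeriv j W y⟫_ℝ) =
        ∑ j, uncurry fun s (y : UnitAddTorus d) => ⟪RU s y j, FunctionSpaces.Torus.partialDeriv j W y⟫_ℝ := by
      funext q; simp [Finset.sum_apply, uncurry]
    rw [e]
    refine Finset.stronglyMeasurable_sum _ fun j _ => ?_
    exact ((continuous_apply j).comp_stronglyMeasurable hRUm).inner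
      ((hW.partialDeriv j).continuous.comp continuous_snd).stronglyMeasurable
  have hb4 : ∀ s y, ‖∑ j, ⟪RU s y j, FunctionSpaces.Torus.partialDeriv j W y⟫_ℝ‖ ≤ Fintype.card d * (A * CP) := fun s y => by
    calc ‖∑ j, ⟪RU s y j, FunctionSpaces.Torus.partialDeriv j W y⟫_ℝ‖ ≤ ∑ j, ‖⟪RU s y j, FunctionSpaces.Torus.partialDeriv j W y⟫_ℝ‖ :=
          norm_sum_le _ _
      _ ≤ ∑ _j : d, A * CP := Finset.sum_le_sum fun j _ => (norm_inner_le_norm _ _).trans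
          (mul_le_mul ((norm_le_pi_norm (RU s y) j).trans (hRUb s y)) (hCP j y) (norm_nonneg _) hA)
      _ = Fintype.card d * (A * CP) := by rw [Finset.sum_const, Finset.card_univ, nsmul_eq_mul]
  have hslm : ∀ {f : ℝ → UnitAddTorus d → ℝ} {C : ℝ}, StronglyMeasurable (uncurry f) → (∀ s y, ‖f s y‖ ≤ C) →
      ∀ s, Integrable (f s) volume := fun {f C} hm hb s =>
    (integrable_const C).mono' (hm.comp_measurable (measurable_const.prodMk measurable_id)).aestronglyMeasurable
      (Eventually.of_forall fun y => hb s y)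
  have hb1 : ∀ s y, ‖⟪U s y, W y⟫_ℝ‖ ≤ M * CW := fun s y => (norm_inner_le_norm _ _).trans (mul_le_mul (hUb s y) (hCW y) (norm_nonneg _) hM)
  have hb2 : ∀ s y, ‖⟪U s y, FunctionSpaces.Torus.convect (U s) W y⟫_ℝ‖ ≤ M * (CD * M) := fun s y =>
    (norm_inner_le_norm _ _).trans (mul_le_mul (hUb s y) (hconv_bd s y) (norm_nonneg _) hM)
  have hb3 : ∀ s y, ‖⟪U s y, FunctionSpaces.Torus.laplacian W y⟫_ℝ‖ ≤ M * CL := fun s y =>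
    (norm_inner_le_norm _ _).trans (mul_le_mul (hUb s y) (hCL y) (norm_nonneg _) hM)
  have hi1 := hslm hjm1 hb1
  have hi2 := hslm hjm2 hb2
  have hi3 := hslm hjm3 hb3
  have hi4 := hslm hjm4 hb4
  -- the slice integrals
  set a : ℝ → ℝ := fun s => ∫ y, ⟪U s y, W y⟫_ℝ with ha
  set b : ℝ → ℝ := fun s => ∫ y, ⟪U s y, FunctionSpaces.Torus.convect (U s) W y⟫_ℝ with hb
  set cL : ℝ → ℝ := fun s => ∫ y, ⟪U s y, FunctionSpaces.Torus.laplacian W y⟫_ℝ with hcL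
  set e : ℝ → ℝ := fun s => ∫ y, ∑ j, ⟪RU s y j, FunctionSpaces.Torus.partialDeriv j W y⟫_ℝ with he
  have hsliceL : ∀ s, ∫ y, ((-deriv ρ (t - s)) * ⟪U s y, W y⟫_ℝ +
      ρ (t - s) * ⟪U s y, FunctionSpaces.Torus.convect (U s) W y⟫_ℝ + ν * (ρ (t - s) * ⟪U s y, FunctionSpaces.Torus.laplacian W y⟫_ℝ)) =
      -(deriv ρ (t - s) * a s) + ρ (t - s) * b s + ν * (ρ (t - s) * cL s) := by
    intro s
    have iAB : Integrable (fun y => (-deriv ρ (t - s)) * ⟪U s y, W y⟫_ℝ +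
        ρ (t - s) * ⟪U s y, FunctionSpaces.Torus.convect (U s) W y⟫_ℝ) volume := ((hi1 s).const_mul _).add ((hi2 s).const_mul _)
    have iC : Integrable (fun y => ν * (ρ (t - s) * ⟪U s y, FunctionSpaces.Torus.laplacian W y⟫_ℝ)) volume :=
      ((hi3 s).const_mul _).const_mul _
    rw [integral_add iAB iC, integral_add ((hi1 s).const_mul _) ((hi2 s).const_mul _), integral_const_mul, integral_const_mul,
      integral_const_mul, integral_const_mul]
    ring
  have hsliceR : ∀ s, ∫ y, ρ (t - s) * ∑ j, ⟪RU s y j, FunctionSpaces.Torus.partialDeriv j W y⟫_ℝ = ρ (t - s) * e s := fun s =>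
    integral_const_mul _ _
  simp_rw [hsliceL, hsliceR] at hid
  -- from `(0, T)` to the whole line
  rw [setIntegral_eq_integral_of_forall_compl_eq_zero (fun s hs => by
      obtain ⟨h0, h0'⟩ := normed_sub_eq_zero_of_not_mem φ ht1 ht2 hs
      change ρ (t - s) = 0 at h0
      change deriv ρ (t - s) = 0 at h0'
      rw [h0, h0']; ring),
    setIntegral_eq_integral_of_forall_compl_eq_zero (fun s hs => by
      obtain ⟨h0, -⟩ := normed_sub_eq_zero_of_not_mem φ ht1 ht2 hs
      change ρ (t - s) = 0 at h0
      rw [h0]; ring)] at hid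
  -- integrability in time
  have ham : AEStronglyMeasurable a volume := (hjm1.integral_prod_right').aestronglyMeasurable
  have hbm : AEStronglyMeasurable b volume := (hjm2.integral_prod_right').aestronglyMeasurable
  have hcLm : AEStronglyMeasurable cL volume := (hjm3.integral_prod_right').aestronglyMeasurable
  have hem : AEStronglyMeasurable e volume := (hjm4.integral_prod_right').aestronglyMeasurable
  have hbdd : ∀ {f : ℝ → UnitAddTorus d → ℝ} {C : ℝ}, (∀ s y, ‖f s y‖ ≤ C) → ∀ s, ‖∫ y, f s y‖ ≤ C := fun {f C} hb s =>
    (norm_integral_le_of_norm_le (integrable_const C) (Eventually.of_forall fun y => hb s y)).trans (by simp)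
  have hρi : Integrable (fun s => ρ (t - s)) volume := φ.integrable_normed.comp_sub_left t
  have hρ'i : Integrable (fun s => deriv ρ (t - s)) volume := (integrable_deriv_normed φ).comp_sub_left t
  have hI1 : Integrable (fun s => deriv ρ (t - s) * a s) volume := hρ'i.mul_bdd ham (Eventually.of_forall (hbdd hb1))
  have hI2 : Integrable (fun s => ρ (t - s) * b s) volume := hρi.mul_bdd hbm (Eventually.of_forall (hbdd hb2))
  have hI3 : Integrable (fun s => ρ (t - s) * cL s) volume := hρi.mul_bdd hcLm (Eventually.of_forall (hbdd hb3))
  have iAB : Integrable (fun s => -(deriv ρ (t - s) * a s) + ρ (t - s) * b s) volume := hI1.fun_neg.add hI2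
  have iC : Integrable (fun s => ν * (ρ (t - s) * cL s)) volume := hI3.const_mul ν
  rw [integral_add iAB iC, integral_add hI1.fun_neg hI2, integral_neg, integral_const_mul] at hid
  linarith

end ProductTestNSR

/-! ## The mollified Navier–Stokes–Reynolds equation up to a gradient -/

section Main

variable {φ : ContDiffBump (0 : ℝ)} {S : Set ℝ} {ν ε T M A : ℝ} {v : ℝ → UnitAddTorus d → EuclideanSpace ℝ d}
  {p : ℝ → UnitAddTorus d → ℝ} {R : ℝ → UnitAddTorus d → d → EuclideanSpace ℝ d}

/-- **The residual of the mollified Navier–Stokes–Reynolds equation**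
`∂ₜV + div 𝒯 - νΔV - div ℛ_ℓ`, for the zero extensions `U`, `RU` of `v`, `R` off `[0, T]`. [cite: BuckmasterVicol2019Annals, §4.1] -/
def mollifiedNSRResidual (φ : ContDiffBump (0 : ℝ)) (ε ν T : ℝ) (v : ℝ → UnitAddTorus d → EuclideanSpace ℝ d)
    (R : ℝ → UnitAddTorus d → d → EuclideanSpace ℝ d) (t : ℝ) (x : UnitAddTorus d) : EuclideanSpace ℝ d :=
  mollifiedEulerResidual φ ε (zeroExt T v) t x - ν • FunctionSpaces.Torus.laplacian (mollifiedField φ ε (zeroExt T v) t) x -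
    tensorDivergence (mollifiedStress φ ε (zeroExt T R) t) x

/-- **The space–time mollification of a classical Navier–Stokes–Reynolds triple solves the system up to a
gradient**: for `(v, p, R)` solving the NSR system with viscosity `ν` on `S ⊇ [0,T]`, sup bounds on the
slab, `0 < ε ≤ 1/4`, and every `t` with `[t - rOut, t + rOut] ⊆ (0, T)`, the residual
`∂ₜV + div 𝒯 - νΔV - div ℛ_ℓ` is `L²`-orthogonal to every smooth divergence-free field. [cite: BuckmasterVicol2019Annals, §4.1] -/
theorem integral_inner_mollifiedNSRResidual_eq_zero (h : IsNSReynoldsOn S ν v p R) (hS : Icc 0 T ⊆ S) (hT : 0 < T)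
    (hvb : ∀ s ∈ Icc 0 T, ∀ y, ‖v s y‖ ≤ M) (hRb : ∀ s ∈ Icc 0 T, ∀ y, ‖R s y‖ ≤ A) (hε : 0 < ε) (hε' : ε ≤ 1 / 4)
    {t : ℝ} (ht1 : φ.rOut < t) (ht2 : t + φ.rOut < T)
    {w : UnitAddTorus d → EuclideanSpace ℝ d} (hw : IsSmooth w) (hdiv : IsDivFree w) :
    ∫ x, ⟪mollifiedNSRResidual φ ε ν T v R t x, w x⟫_ℝ = 0 := by
  set U := zeroExt T v with hUdef
  set RU := zeroExt T R with hRUdef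
  have hT0 : (0 : ℝ) ≤ T := hT.le
  have hM : 0 ≤ M := (norm_nonneg _).trans (hvb 0 ⟨le_rfl, hT0⟩ 0)
  have hA : 0 ≤ A := (norm_nonneg _).trans (hRb 0 ⟨le_rfl, hT0⟩ 0)
  have hIcc := h.mono_Icc hS hT
  have hUm : StronglyMeasurable (uncurry U) := stronglyMeasurable_uncurry_zeroExt hT0 hIcc.smooth_velocity
  have hRUm : StronglyMeasurable (uncurry RU) := stronglyMeasurable_uncurry_zeroExt hT0 hIcc.smooth_stress
  have hUb : ∀ s y, ‖U s y‖ ≤ M := norm_zeroExt_le hM hvb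
  have hRUb : ∀ s y, ‖RU s y‖ ≤ A := norm_zeroExt_le hA hRb
  have hU0 : ∀ s, s ∉ Icc 0 T → U s = 0 := fun s hs => zeroExt_of_not_mem v hs
  have hRU0 : ∀ s, s ∉ Icc 0 T → RU s = 0 := fun s hs => zeroExt_of_not_mem R hs
  have hUi : Integrable (uncurry U) ((volume : Measure ℝ).prod volume) := integrable_uncurry_of_bounded hUm hUb hU0
  have hks : IsSmooth (kernel (d := d) ε) := FunctionSpaces.Torus.isSmooth_kernel hε hε'
  -- the mollified test field
  have hW : IsSmooth (vecMollify ε w) := FunctionSpaces.Torus.isSmooth_vecMollify hw.integrable hε hε'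
  have hWdiv : IsDivFree (vecMollify ε w) := FunctionSpaces.Torus.IsDivFree.vecConv hw hdiv hks
  -- the steps
  have h1 := weakNSR_product_test (φ := φ) h hS hT hvb hRb ht1 ht2 hW hWdiv
  have h2 := integral_inner_timeDeriv_mollifiedField (φ := φ) hUm hUb hU0 hε hε' hw t
  have h3 := integral_inner_tensorDivergence_mollifiedFlux (φ := φ) hUm hUb hU0 hε hε' hw t
  have h4 := integral_inner_laplacian_mollifiedField (φ := φ) hUm hUb hU0 hε hε' hw t
  have h5 := integral_inner_tensorDivergence_mollifiedStress (φ := φ) hRUm hRUb hRU0 hε hε' hw t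
  -- split the residual
  have hc1 : Continuous (FunctionSpaces.Torus.timeDeriv (mollifiedField φ ε U) t) :=
    (continuous_uncurry_timeDeriv_mollifiedField hUi hε hε' hU0).uncurry_left t
  have hc2 : Continuous (tensorDivergence (mollifiedFlux φ ε U t)) :=
    (isSmooth_mollifiedFlux (φ := φ) hUm hUb hU0 hε hε' t).tensorDivergence.continuous
  have hc3 : Continuous (FunctionSpaces.Torus.laplacian (mollifiedField φ ε U t)) :=
    (isSmooth_mollifiedField hUi hε hε' t).laplacian.continuous
  have hc4 : Continuous (tensorDivergence (mollifiedStress φ ε RU t)) :=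
    (isSmooth_mollifiedStress (φ := φ) hRUm hRUb hRU0 hε hε' t).tensorDivergence.continuous
  have hint : ∀ {f : UnitAddTorus d → EuclideanSpace ℝ d}, Continuous f → Integrable (fun x => ⟪f x, w x⟫_ℝ) volume :=
    fun hf => (hf.inner hw.continuous).integrable_unitAddTorus
  have hsplit : ∫ x, ⟪mollifiedNSRResidual φ ε ν T v R t x, w x⟫_ℝ =
      (∫ x, ⟪FunctionSpaces.Torus.timeDeriv (mollifiedField φ ε U) t x, w x⟫_ℝ) +
        (∫ x, ⟪tensorDivergence (mollifiedFlux φ ε U t) x, w x⟫_ℝ) -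
        ν * (∫ x, ⟪FunctionSpaces.Torus.laplacian (mollifiedField φ ε U t) x, w x⟫_ℝ) -
        ∫ x, ⟪tensorDivergence (mollifiedStress φ ε RU t) x, w x⟫_ℝ := by
    have i12 : Integrable (fun x => ⟪FunctionSpaces.Torus.timeDeriv (mollifiedField φ ε U) t x, w x⟫_ℝ +
        ⟪tensorDivergence (mollifiedFlux φ ε U t) x, w x⟫_ℝ) volume := (hint hc1).add (hint hc2)
    have i3 : Integrable (fun x => ν * ⟪FunctionSpaces.Torus.laplacian (mollifiedField φ ε U t) x, w x⟫_ℝ) volume := (hint hc3).const_mul ν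
    have i123 : Integrable (fun x => ⟪FunctionSpaces.Torus.timeDeriv (mollifiedField φ ε U) t x, w x⟫_ℝ +
        ⟪tensorDivergence (mollifiedFlux φ ε U t) x, w x⟫_ℝ - ν * ⟪FunctionSpaces.Torus.laplacian (mollifiedField φ ε U t) x, w x⟫_ℝ)
        volume := i12.sub i3
    rw [← integral_add (hint hc1) (hint hc2), ← integral_const_mul, ← integral_sub i12 i3, ← integral_sub i123 (hint hc4)]
    refine integral_congr_ae (Eventually.of_forall fun x => ?_)
    show ⟪mollifiedNSRResidual φ ε ν T v R t x, w x⟫_ℝ = _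
    simp only [mollifiedNSRResidual, mollifiedEulerResidual_apply, inner_sub_left, inner_add_left, inner_smul_left,
      RCLike.conj_to_real, hUdef, hRUdef]
  rw [hsplit, h2, h3, h4, h5, h1]
  ring

end Main

end Torus

end Literature.Analysis.FluidPDE
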